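import Mathlib

/-!
# Tier4/Line1/AdicIntegersCompact — the local integers `𝓞_v` of a number field are compact (towards (I1-g) of LINE L1)

Blind re-derivation cell `pub-hodge-repro`, Tier 4 (README §9–§10), seat t4-L1-p5 (prover, LINE L1, gen 0).
Mathlib only.  (I1-g) `locallyCompact_GA` of `Skeleton.lean` v0.10 (L657) needs the local compactness of the finite
adele ring `𝔸_{k,f} = Πʳ_v [k_v, 𝓞_v]`, which Mathlib's restricted-product instance gives once every `𝓞_v` is compact.
Mathlib (rev 81a5d257c8e4) has the criterion `Valued.integer.compactSpace_iff_completeSpace_and_isDiscreteValuationRing_and_finite_residueField`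
but NOT the finiteness of the residue field of `𝓞_v`; this file supplies it: the residue map `𝓞_k → 𝓞_v → 𝓞_v/𝔪_v` is
surjective (density of `k` in `k_v` plus `HeightOneSpectrum.exists_valuation_sub_lt_of_integer`) with kernel
containing `𝔭 = v.asIdeal`, and `𝓞_k/𝔭` is finite (`Ideal.finiteQuotientOfFreeOfNeBot`).

Nothing here says anything about the status of the Hodge conjecture for CM abelian varieties, which is NOT proved
(HC_CM is NOT proved by anyone in this repository).
-/

set_option autoImplicit false

noncomputable section

namespace Summit.Ventures.HodgeRepro.Tier4.Line1

open NumberField IsDedekindDomain HeightOneSpectrum Topology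

section AdicIntegers

variable (k : Type) [Field k] [NumberField k] (v : HeightOneSpectrum (𝓞 k))

/-- **Approximation of local integers by global ones**: every `x ∈ 𝓞_v` is within `v(x − a) < 1` of some `a ∈ 𝓞_k`
(`k` is dense in `k_v`, and an element of `k` which is `v`-integral is `v`-adically close to an element of `𝓞_k`). -/
theorem exists_ringOfIntegers_valued_sub_lt_one (x : v.adicCompletion k) (hx : Valued.v x ≤ 1) :
    ∃ a : 𝓞 k, Valued.v (x - algebraMap (𝓞 k) (v.adicCompletion k) a) < 1 := by
  have hball : Metric.ball x 1 ∈ 𝓝 x := Metric.ball_mem_nhds x one_pos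
  obtain ⟨b, hb⟩ := (denseRange_algebraMap k v).mem_nhds hball
  rw [Metric.mem_ball, dist_eq_norm, Valued.toNormedField.norm_lt_one_iff] at hb
  have hvb : v.valuation k b ≤ 1 := by
    have h1 : Valued.v (algebraMap k (v.adicCompletion k) b) ≤ 1 := by
      have e : algebraMap k (v.adicCompletion k) b = x + (algebraMap k (v.adicCompletion k) b - x) := by
        ring
      rw [e]
      exact (Valuation.map_add _ _ _).trans (max_le hx hb.le)
    rwa [show algebraMap k (v.adicCompletion k) b = (b : v.adicCompletion k) from rfl,
      valuedAdicCompletion_eq_valuation'] at h1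
  obtain ⟨a, ha⟩ := exists_valuation_sub_lt_of_integer v hvb 1
  refine ⟨a, ?_⟩
  have e : x - algebraMap (𝓞 k) (v.adicCompletion k) a =
      (x - algebraMap k (v.adicCompletion k) b) +
        algebraMap k (v.adicCompletion k) (b - algebraMap (𝓞 k) k a) := by
    rw [IsScalarTower.algebraMap_apply (𝓞 k) k (v.adicCompletion k), map_sub]
    ring
  rw [e]
  refine lt_of_le_of_lt (Valuation.map_add _ _ _) (max_lt ?_ ?_)
  · rwa [Valuation.map_sub_swap]
  · rw [show algebraMap k (v.adicCompletion k) (b - algebraMap (𝓞 k) k a) =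
        ((b - algebraMap (𝓞 k) k a : k) : v.adicCompletion k) from rfl,
      valuedAdicCompletion_eq_valuation', Valuation.map_sub_swap]
    simpa using ha

/-- **The residue field of `𝓞_v` is finite**: `𝓞_k/𝔭 ↠ 𝓞_v/𝔪_v`. -/
theorem finite_residueField_adicCompletionIntegers :
    Finite (IsLocalRing.ResidueField (v.adicCompletionIntegers k)) := by
  classical
  let φ : 𝓞 k →+* IsLocalRing.ResidueField (v.adicCompletionIntegers k) :=
    (IsLocalRing.residue (v.adicCompletionIntegers k)).comp
      (algebraMap (𝓞 k) (v.adicCompletionIntegers k))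
  -- the kernel contains `𝔭`
  have hker : ∀ a ∈ v.asIdeal, φ a = 0 := by
    intro a ha
    show IsLocalRing.residue _ (algebraMap (𝓞 k) (v.adicCompletionIntegers k) a) = 0
    rw [IsLocalRing.residue_eq_zero_iff]
    unfold HeightOneSpectrum.adicCompletionIntegers
    rw [Valuation.mem_maximalIdeal_iff]
    show Valued.v (algebraMap (𝓞 k) (v.adicCompletionIntegers k) a : v.adicCompletion k) < 1
    rw [algebraMap_adicCompletionIntegers_apply, valuedAdicCompletion_eq_valuation',
      valuation_of_algebraMap]
    exact (intValuation_lt_one_iff_mem v a).2 ha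
  -- surjectivity
  have hsurj : Function.Surjective φ := by
    intro y
    obtain ⟨x, rfl⟩ := IsLocalRing.residue_surjective y
    obtain ⟨a, ha⟩ := exists_ringOfIntegers_valued_sub_lt_one k v (x : v.adicCompletion k)
      ((mem_adicCompletionIntegers (𝓞 k) k v).1 x.2)
    refine ⟨a, ?_⟩
    show IsLocalRing.residue _ (algebraMap (𝓞 k) (v.adicCompletionIntegers k) a) =
      IsLocalRing.residue _ x
    rw [← sub_eq_zero, ← map_sub, IsLocalRing.residue_eq_zero_iff]
    unfold HeightOneSpectrum.adicCompletionIntegers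
    rw [Valuation.mem_maximalIdeal_iff]
    show Valued.v ((algebraMap (𝓞 k) (v.adicCompletionIntegers k) a : v.adicCompletion k) - x) < 1
    rw [algebraMap_adicCompletionIntegers_apply, Valuation.map_sub_swap]
    exact ha
  -- factor through the finite quotient `𝓞_k/𝔭`
  haveI : Finite (𝓞 k ⧸ v.asIdeal) := v.asIdeal.finiteQuotientOfFreeOfNeBot v.ne_bot
  have hlift : Function.Surjective (Ideal.Quotient.lift v.asIdeal φ hker) := by
    intro y
    obtain ⟨a, ha⟩ := hsurj y
    exact ⟨Ideal.Quotient.mk _ a, by simpa using ha⟩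
  exact Finite.of_surjective _ hlift

/-- **`𝓞_v` is compact** (Mathlib's criterion: complete, discretely valued, finite residue field). -/
theorem compactSpace_adicCompletionIntegers : CompactSpace (v.adicCompletionIntegers k) := by
  have key : CompactSpace (Valued.integer (v.adicCompletion k)) := by
    rw [Valued.integer.compactSpace_iff_completeSpace_and_isDiscreteValuationRing_and_finite_residueField]
    refine ⟨?_, ?_, ?_⟩
    · exact (Valued.isClosed_integer (v.adicCompletion k)).completeSpace_coe
    · exact inferInstanceAs (IsDiscreteValuationRing (v.adicCompletionIntegers k))
    · exact finite_residueField_adicCompletionIntegers k v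
  exact key

/-- The same, as compactness of the subset `𝓞_v ⊆ k_v`. -/
theorem isCompact_adicCompletionIntegers :
    IsCompact (v.adicCompletionIntegers k : Set (v.adicCompletion k)) :=
  isCompact_iff_compactSpace.2 (compactSpace_adicCompletionIntegers k v)

end AdicIntegers

end Summit.Ventures.HodgeRepro.Tier4.Line1

end
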